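import Summits.BirchSwinnertonDyer.BirchSwinnertonDyer.Theorems.ResidualThetaTransportAtTwoThetaLayerLambdaCongruenceAtTwoCuspSpanEllipticFamiliesQuadratic
import HarnessLib

/-!
# Route `ResidualThetaTransportAtTwo`, node (G′)_N = `CuspSpanEvenAtTwo N` (item 27436; cruxes Kan⁺ 20688 / Kμ⁺ / 21437):
# CYCLOTOMIC COMPLETENESS ⟹ the node at a prime level — the uniform road beyond the seed families

Cell `bsd-wall`, width seat `bsd-wall-rtt-p3-w3` g7 (2026-08-28). THEOREMS ONLY; `--supports stmt-BirchSwinnertonDyer-20688`; BSD is not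
proved by this. Setting as in `…CuspSpanEllipticFamilies`: `p` an odd prime, `χ : Γ₀(p) → ZMod 2` admissible (additive, killing the
elements of trace `0, ±1, ±2` and the `4^k`-classes), `F(u) = χ(β_u)` its `B₁`-character (`d(β_u) ≡ u`), with the lead's
4-invariance `F(4u) = F(u)` (`…CuspSpanFourInvariance`).

THEOREM G (`cuspSpanTrace_of_cyclotomic_pairs`, `cuspSpanEvenAtTwo_of_cyclotomic_pairs`). Suppose that for all units `x, y` of
`ℤ/p` there are `k, l` with `4^k x + 4^l y = 1` — i.e. every pair of cosets of `⟨4⟩` is realised as `(v, 1 − v)`: ALL CYCLOTOMIC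
NUMBERS of order `n = [(ℤ/p)ˣ : ⟨4⟩]` are positive. Then (G″)_p holds (with `ψ = 0`, or `ψ` = the quadratic character when
`p ≡ 1 (mod 8)`), hence `CuspSpanEvenAtTwo p`.
PROOF. The three-term rule for `u = (1 − v)⁻¹` reads `F(u) + F(v) + F(uv) = 0`; with `v = 4^k x`, `1 − v = 4^l y` and 4-invariance
this is `F(y⁻¹) + F(x) + F(x/y) = 0` for ALL units `x, y` (§2 `chi_sum3_of_cyclotomic_pairs`); `x = y` gives `F(y⁻¹) = F(y)`, so
`F(x/y) = F(x) + F(y)`: `F` is a HOMOMORPHISM `(ℤ/p)ˣ → 𝔽₂`. Hence `F(s²) = 0` (`K` on the quadratic residues) and `F(r) = F(r')`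
for non-residues `r, r'` (`E`); the lead's `cuspSpanTrace_of_quadratic_certificate` assembles (G″)_p when `p ≡ 1 (mod 8)`, and
otherwise a non-residue elementary zero (`−1` if `p ≡ 3 (mod 4)`, `i` if `p ≡ 5 (mod 8)`) forces `F ≡ 0`.
SCOPE. By the Weil bound for Jacobi sums every cyclotomic number of order `n` is positive once `p ≫ n⁴`; so Theorem G covers every
prime with `ord_p 4 ≳ p^{3/4}` — but that input is analytic and NOT in this file: the hypothesis is stated per level (decidable,
`∀ x y, ∃ k l < ord_p 4`). The seed families A/B′/E′/C′ (`…CuspSpanGeneration`, `…CuspSpanEllipticFamilies`, `…Quadratic`) are the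
small-index cases where no pair is needed.

References: R. Pollack, Duke Math. J. 118 (2003) Conj. 6.3 [Pollack2003]; H. Rademacher, Abh. Math. Sem. Hamburg 7 (1929) §1
[Rademacher1929]; A. W. Knapp, *Elliptic curves* (1992) Prop. 11.1 [Knapp1993]; Mathlib `ZMod.euler_criterion`.
-/

set_option autoImplicit false
set_option linter.dupNamespace false

noncomputable section

open scoped MatrixGroups

open CongruenceSubgroup

namespace Summit.BirchSwinnertonDyer.BirchSwinnertonDyer.Theorems.SignedMuAtTwo

/-! ## §1. The three-term rule as a value identity at residue level (any level) -/

section AnyLevel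

variable {N : ℕ} {χ : Gamma0 N → ZMod 2}

/-- **Three-term identity** `F(u) + F(v) + F(uv) = 0` for units `u, v` with `u(1 − v) = 1` (i.e. `u⁻¹ + v = 1`): any three `B₁`
elements with residues `u, v, uv` (`chi_add_chi_eq_of_pos` on the explicit elements `(1 − v, −1; ·, u)`, `(v⁻¹, −1; ·, v)`,
transported by the residue invariance on `B₁`). [cite: Knapp1993, Prop. 11.1] -/
theorem chi_sum3_of_mul_one_sub_eq_one [NeZero N] (hadd : ∀ γ δ : Gamma0 N, χ (γ * δ) = χ γ + χ δ)
    (hsmall : ∀ γ : Gamma0 N, ((γ : SL(2, ℤ)) 0 0 + (γ : SL(2, ℤ)) 1 1).natAbs ≤ 2 → χ γ = 0)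
    (u v : ZMod N) (hv : IsUnit v) (h : u * (1 - v) = 1) :
    ∀ β₁ β₂ β₃ : Gamma0 N, (β₁ : SL(2, ℤ)) 0 1 = -1 → (β₂ : SL(2, ℤ)) 0 1 = -1 → (β₃ : SL(2, ℤ)) 0 1 = -1 →
      ((((β₁ : SL(2, ℤ)) 1 1 : ℤ) : ZMod N)) = u → ((((β₂ : SL(2, ℤ)) 1 1 : ℤ) : ZMod N)) = v →
      ((((β₃ : SL(2, ℤ)) 1 1 : ℤ) : ZMod N)) = u * v → χ β₁ + χ β₂ + χ β₃ = 0 := by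
  intro β₁ β₂ β₃ h1 h2 h3 hd1 hd2 hd3
  have hc₁ : (N : ℤ) ∣ 1 - (1 - (v.val : ℤ)) * (u.val : ℤ) := by
    refine (ZMod.intCast_zmod_eq_zero_iff_dvd _ N).mp ?_
    push_cast; rw [ZMod.natCast_zmod_val, ZMod.natCast_zmod_val]; linear_combination -h
  obtain ⟨β₁', e00, e01, e10, e11⟩ :=
    ThetaLayerLambdaCongruenceAtTwo.exists_gamma0_entries (N := N) (1 - (v.val : ℤ)) (-1)
      (1 - (1 - (v.val : ℤ)) * (u.val : ℤ)) (u.val : ℤ) (by ring) hc₁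
  have hv' : IsUnit (((v.val : ℤ) : ZMod N)) := by rw [Int.cast_natCast, ZMod.natCast_zmod_val]; exact hv
  obtain ⟨κ₂, a₂, hκa⟩ := (ZMod.coe_int_isUnit_iff_isCoprime (v.val : ℤ) N).mp hv'
  obtain ⟨β₂', f00, f01, f10, f11⟩ :=
    ThetaLayerLambdaCongruenceAtTwo.exists_gamma0_entries (N := N) a₂ (-1) ((N : ℤ) * κ₂) (v.val : ℤ)
      (by linear_combination hκa) (dvd_mul_right _ _)
  have hr1 : ((((β₁' : SL(2, ℤ)) 1 1 : ℤ) : ZMod N)) = u := by rw [e11, Int.cast_natCast, ZMod.natCast_zmod_val]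
  have hr2 : ((((β₂' : SL(2, ℤ)) 1 1 : ℤ) : ZMod N)) = v := by rw [f11, Int.cast_natCast, ZMod.natCast_zmod_val]
  have hsum : χ β₁' + χ β₂' = χ β₃ :=
    chi_add_chi_eq_of_pos hadd hsmall e01 f01 h3 (by rw [e00, f11]; ring)
      (by rw [hd3, e11, f11]; push_cast; rw [ZMod.natCast_zmod_val, ZMod.natCast_zmod_val])
  rw [chi_eq_of_apply_zero_one_eq_neg_one hadd hsmall h1 e01 (by rw [hd1, hr1]),
    chi_eq_of_apply_zero_one_eq_neg_one hadd hsmall h2 f01 (by rw [hd2, hr2]), hsum]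
  have key : ∀ x : ZMod 2, x + x = 0 := by decide
  exact key _

end AnyLevel

/-! ## §2. Cyclotomic pairs make `F` a homomorphism -/

section PrimeLevel

variable {p : ℕ} [Fact p.Prime] {χ : Gamma0 p → ZMod 2}

/-- **`F(y⁻¹) + F(x) + F(x/y) = 0`** for all units `x, y`, given the cyclotomic pairs (`4^k x + 4^l y = 1`): the three-term rule at
`v = 4^k x`, `u = (4^l y)⁻¹`, with 4-invariance `F(4^k x) = F(x)`, `F((4^l y)⁻¹) = F(y⁻¹)`, `F(uv) = F(x/y)`. [cite: Pollack2003, Conj. 6.3] -/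
theorem chi_sum3_of_cyclotomic_pairs (hp2 : p ≠ 2)
    (hpairs : ∀ x y : ZMod p, x ≠ 0 → y ≠ 0 → ∃ k l : ℕ, (4 : ZMod p) ^ k * x + 4 ^ l * y = 1)
    (hadd : ∀ γ δ : Gamma0 p, χ (γ * δ) = χ γ + χ δ)
    (hsmall : ∀ γ : Gamma0 p, ((γ : SL(2, ℤ)) 0 0 + (γ : SL(2, ℤ)) 1 1).natAbs ≤ 2 → χ γ = 0)
    (hkill : ∀ γ : Gamma0 p, (∃ k : ℕ, 1 ≤ k ∧ ((γ : SL(2, ℤ)) 1 1).natAbs = 4 ^ k) → χ γ = 0)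
    {x y : ZMod p} (hx : x ≠ 0) (hy : y ≠ 0) :
    ∀ β₁ β₂ β₃ : Gamma0 p, (β₁ : SL(2, ℤ)) 0 1 = -1 → (β₂ : SL(2, ℤ)) 0 1 = -1 → (β₃ : SL(2, ℤ)) 0 1 = -1 →
      ((((β₁ : SL(2, ℤ)) 1 1 : ℤ) : ZMod p)) = y⁻¹ → ((((β₂ : SL(2, ℤ)) 1 1 : ℤ) : ZMod p)) = x →
      ((((β₃ : SL(2, ℤ)) 1 1 : ℤ) : ZMod p)) = x * y⁻¹ → χ β₁ + χ β₂ + χ β₃ = 0 := by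
  intro β₁ β₂ β₃ h1 h2 h3 hd1 hd2 hd3
  obtain ⟨k, l, hkl⟩ := hpairs x y hx hy
  have h4 : (4 : ZMod p) ≠ 0 := by
    intro h
    have h' : ((4 : ℕ) : ZMod p) = 0 := by exact_mod_cast h
    have hdvd := (ZMod.natCast_eq_zero_iff 4 p).mp h'
    have hp : p.Prime := Fact.out
    have : p ∣ 2 ^ 2 := by simpa using hdvd
    exact hp2 ((Nat.prime_dvd_prime_iff_eq hp Nat.prime_two).mp (hp.dvd_of_dvd_pow this))
  have h4u : IsUnit (4 : ZMod p) := isUnit_iff_ne_zero.mpr h4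
  set v : ZMod p := 4 ^ k * x with hv
  set w : ZMod p := 4 ^ l * y with hw
  have hv0 : v ≠ 0 := mul_ne_zero (pow_ne_zero _ h4) hx
  have hw0 : w ≠ 0 := mul_ne_zero (pow_ne_zero _ h4) hy
  have hwv : w = 1 - v := by rw [hv, hw]; linear_combination hkl
  set u : ZMod p := w⁻¹ with hu
  have huv : u * (1 - v) = 1 := by rw [← hwv, hu, inv_mul_cancel₀ hw0]
  have hvu : IsUnit v := isUnit_iff_ne_zero.mpr hv0
  have S := chi_sum3_of_mul_one_sub_eq_one hadd hsmall u v hvu huv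
  -- intermediate `B₁` elements with residues `u`, `v`, `4^l (u v)`
  obtain ⟨βu, hbu, hdu⟩ := exists_b_neg_one_of_isUnit (N := p) (isUnit_iff_ne_zero.mpr (inv_ne_zero hw0) : IsUnit u)
  obtain ⟨βv, hbv, hdv⟩ := exists_b_neg_one_of_isUnit (N := p) hvu
  obtain ⟨βuv, hbuv, hduv⟩ := exists_b_neg_one_of_isUnit (N := p)
    ((isUnit_iff_ne_zero.mpr (inv_ne_zero hw0) : IsUnit u).mul hvu)
  obtain ⟨βa, hba, hda⟩ := exists_b_neg_one_of_isUnit (N := p)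
    ((h4u.pow l).mul (((isUnit_iff_ne_zero.mpr (inv_ne_zero hw0) : IsUnit u).mul hvu)))
  have hS := S βu βv βuv hbu hbv hbuv hdu hdv hduv
  -- `F(y⁻¹) = F(u)`: `y⁻¹ = 4^l u`
  have e1 : χ β₁ = χ βu :=
    chi_eq_of_b_neg_one_of_d_eq_four_pow_mul hp2 hadd hsmall hkill l h1 hbu
      (by rw [hd1, hdu, hu, hw, mul_inv, ← mul_assoc, mul_inv_cancel₀ (pow_ne_zero _ h4), one_mul])
  -- `F(x) = F(v)`: `v = 4^k x`
  have e2 : χ βv = χ β₂ :=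
    chi_eq_of_b_neg_one_of_d_eq_four_pow_mul hp2 hadd hsmall hkill k hbv h2 (by rw [hdv, hd2])
  -- `F(x/y) = F(uv)`: `4^l (u v) = 4^k (x y⁻¹)`
  have e3a : χ βa = χ βuv :=
    chi_eq_of_b_neg_one_of_d_eq_four_pow_mul hp2 hadd hsmall hkill l hba hbuv (by rw [hda, hduv])
  have e3b : χ βa = χ β₃ :=
    chi_eq_of_b_neg_one_of_d_eq_four_pow_mul hp2 hadd hsmall hkill k hba h3 (by
      rw [hda, hd3, hu, hw, hv, mul_inv]
      field_simp)
  rw [e1, ← e2, ← e3b, e3a]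
  exact hS

/-- **`F` is a homomorphism**: `F(y) + F(x) + F(x/y) = 0` for all units — first `F(y⁻¹) = F(y)` (the case `x = y` of the previous
identity, `F(1) = 0`), then substitute. [cite: Pollack2003, Conj. 6.3] -/
theorem chi_sum3_div_of_cyclotomic_pairs (hp2 : p ≠ 2)
    (hpairs : ∀ x y : ZMod p, x ≠ 0 → y ≠ 0 → ∃ k l : ℕ, (4 : ZMod p) ^ k * x + 4 ^ l * y = 1)
    (hadd : ∀ γ δ : Gamma0 p, χ (γ * δ) = χ γ + χ δ)
    (hsmall : ∀ γ : Gamma0 p, ((γ : SL(2, ℤ)) 0 0 + (γ : SL(2, ℤ)) 1 1).natAbs ≤ 2 → χ γ = 0)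
    (hkill : ∀ γ : Gamma0 p, (∃ k : ℕ, 1 ≤ k ∧ ((γ : SL(2, ℤ)) 1 1).natAbs = 4 ^ k) → χ γ = 0)
    {x y : ZMod p} (hx : x ≠ 0) (hy : y ≠ 0) :
    ∀ β₁ β₂ β₃ : Gamma0 p, (β₁ : SL(2, ℤ)) 0 1 = -1 → (β₂ : SL(2, ℤ)) 0 1 = -1 → (β₃ : SL(2, ℤ)) 0 1 = -1 →
      ((((β₁ : SL(2, ℤ)) 1 1 : ℤ) : ZMod p)) = y → ((((β₂ : SL(2, ℤ)) 1 1 : ℤ) : ZMod p)) = x →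
      ((((β₃ : SL(2, ℤ)) 1 1 : ℤ) : ZMod p)) = x * y⁻¹ → χ β₁ + χ β₂ + χ β₃ = 0 := by
  intro β₁ β₂ β₃ h1 h2 h3 hd1 hd2 hd3
  -- `F(y⁻¹) = F(y)`
  obtain ⟨βi, hbi, hdi⟩ := exists_b_neg_one_of_isUnit (N := p) (isUnit_iff_ne_zero.mpr (inv_ne_zero hy))
  obtain ⟨β1, hb1, hd1'⟩ := exists_b_neg_one_of_isUnit (N := p) (isUnit_one : IsUnit (1 : ZMod p))
  have hyy := chi_sum3_of_cyclotomic_pairs hp2 hpairs hadd hsmall hkill hy hy βi β₁ β1 hbi h1 hb1 hdi hd1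
    (by rw [hd1', mul_inv_cancel₀ hy])
  have h10 : χ β1 = 0 := chi_eq_zero_of_b_neg_one_of_elementary hadd hsmall hb1 hd1' (Or.inl rfl)
  rw [h10, add_zero] at hyy
  have k1 : ∀ a b : ZMod 2, a + b = 0 → a = b := by decide
  have hinv : χ βi = χ β₁ := k1 _ _ hyy
  rw [← hinv]
  exact chi_sum3_of_cyclotomic_pairs hp2 hpairs hadd hsmall hkill hx hy βi β₂ β₃ hbi h2 h3 hdi hd2 hd3

/-- **`K` on squares**: `F(s²) = 0` for every unit `s` (from `F(s) + F(s²) + F(s) = 0`). [cite: Pollack2003, Conj. 6.3] -/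
theorem K_sq_of_cyclotomic_pairs (hp2 : p ≠ 2)
    (hpairs : ∀ x y : ZMod p, x ≠ 0 → y ≠ 0 → ∃ k l : ℕ, (4 : ZMod p) ^ k * x + 4 ^ l * y = 1)
    (hadd : ∀ γ δ : Gamma0 p, χ (γ * δ) = χ γ + χ δ)
    (hsmall : ∀ γ : Gamma0 p, ((γ : SL(2, ℤ)) 0 0 + (γ : SL(2, ℤ)) 1 1).natAbs ≤ 2 → χ γ = 0)
    (hkill : ∀ γ : Gamma0 p, (∃ k : ℕ, 1 ≤ k ∧ ((γ : SL(2, ℤ)) 1 1).natAbs = 4 ^ k) → χ γ = 0)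
    {s : ZMod p} (hs : s ≠ 0) :
    ∀ β : Gamma0 p, (β : SL(2, ℤ)) 0 1 = -1 → ((((β : SL(2, ℤ)) 1 1 : ℤ) : ZMod p)) = s * s → χ β = 0 := by
  intro β hb hd
  obtain ⟨βs, hbs, hds⟩ := exists_b_neg_one_of_isUnit (N := p) (isUnit_iff_ne_zero.mpr hs)
  have h := chi_sum3_div_of_cyclotomic_pairs hp2 hpairs hadd hsmall hkill (mul_ne_zero hs hs) hs βs β βs hbs hb hbs hds hd
    (by rw [hds, mul_assoc, mul_inv_cancel₀ hs, mul_one])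
  have k5 : ∀ a b : ZMod 2, a + b + a = 0 → b = 0 := by decide
  exact k5 _ _ h

/-- **`E` between residues whose quotient is a square**: `F(r) = F(r')` when `r/r' = s²`. [cite: Pollack2003, Conj. 6.3] -/
theorem E_of_div_sq_of_cyclotomic_pairs (hp2 : p ≠ 2)
    (hpairs : ∀ x y : ZMod p, x ≠ 0 → y ≠ 0 → ∃ k l : ℕ, (4 : ZMod p) ^ k * x + 4 ^ l * y = 1)
    (hadd : ∀ γ δ : Gamma0 p, χ (γ * δ) = χ γ + χ δ)
    (hsmall : ∀ γ : Gamma0 p, ((γ : SL(2, ℤ)) 0 0 + (γ : SL(2, ℤ)) 1 1).natAbs ≤ 2 → χ γ = 0)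
    (hkill : ∀ γ : Gamma0 p, (∃ k : ℕ, 1 ≤ k ∧ ((γ : SL(2, ℤ)) 1 1).natAbs = 4 ^ k) → χ γ = 0)
    {r r' s : ZMod p} (hr : r ≠ 0) (hr' : r' ≠ 0) (hs : s ≠ 0) (hrs : r * r'⁻¹ = s * s) :
    ∀ β β' : Gamma0 p, (β : SL(2, ℤ)) 0 1 = -1 → (β' : SL(2, ℤ)) 0 1 = -1 →
      ((((β : SL(2, ℤ)) 1 1 : ℤ) : ZMod p)) = r → ((((β' : SL(2, ℤ)) 1 1 : ℤ) : ZMod p)) = r' → χ β = χ β' := by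
  intro β β' hb hb' hd hd'
  obtain ⟨βq, hbq, hdq⟩ := exists_b_neg_one_of_isUnit (N := p) (isUnit_iff_ne_zero.mpr (mul_ne_zero hs hs))
  have h := chi_sum3_div_of_cyclotomic_pairs hp2 hpairs hadd hsmall hkill hr hr' β' β βq hb' hb hbq hd' hd
    (by rw [hdq, ← hrs])
  rw [K_sq_of_cyclotomic_pairs hp2 hpairs hadd hsmall hkill hs βq hbq hdq, add_zero] at h
  have k1 : ∀ a b : ZMod 2, a + b = 0 → b = a := by decide
  exact k1 _ _ h

/-! ## §3. THEOREM G -/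

/-- **THEOREM G (trace form).** At an odd prime level, if every pair of cosets of `⟨4⟩` is realised as `(v, 1 − v)`
(`∀ x y ≠ 0, ∃ k l, 4^k x + 4^l y = 1` — all cyclotomic numbers of order `[(ℤ/p)ˣ : ⟨4⟩]` positive), then (G″)_p: every admissible
`χ` is `ψ ∘ d` with `ψ` multiplicative on units. [cite: Pollack2003, Conj. 6.3] [cite: Rademacher1929, §1] -/
theorem cuspSpanTrace_of_cyclotomic_pairs (hp2 : p ≠ 2)
    (hpairs : ∀ x y : ZMod p, x ≠ 0 → y ≠ 0 → ∃ k l : ℕ, (4 : ZMod p) ^ k * x + 4 ^ l * y = 1) :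
    ∀ χ : Gamma0 p → ZMod 2,
      (∀ γ δ : Gamma0 p, χ (γ * δ) = χ γ + χ δ) →
      (∀ γ : Gamma0 p, ((γ : SL(2, ℤ)) 0 0 + (γ : SL(2, ℤ)) 1 1).natAbs ≤ 2 → χ γ = 0) →
      (∀ γ : Gamma0 p, (∃ k : ℕ, 1 ≤ k ∧ ((γ : SL(2, ℤ)) 1 1).natAbs = 4 ^ k) → χ γ = 0) →
      ∃ ψ : ZMod p → ZMod 2, (∀ x y : ZMod p, IsUnit x → IsUnit y → ψ (x * y) = ψ x + ψ y) ∧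
        ∀ γ : Gamma0 p, χ γ = ψ ((((γ : SL(2, ℤ)) 1 1 : ℤ) : ZMod p)) := by
  intro χ hadd hsmall hkill
  have hp : p.Prime := Fact.out
  have hm11 : (-1 : ZMod p) ≠ 1 := by
    intro h
    have h2 : ((2 : ℕ) : ZMod p) = 0 := by
      have : (2 : ZMod p) = 0 := by linear_combination -h
      exact_mod_cast this
    exact hp2 ((Nat.prime_dvd_prime_iff_eq hp Nat.prime_two).mp ((ZMod.natCast_eq_zero_iff 2 p).mp h2))
  -- residues: `K`; non-residues: all `F`-values equal
  have hKres : ∀ r : ZMod p, r ≠ 0 → r ^ (p / 2) = 1 →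
      ∀ β : Gamma0 p, (β : SL(2, ℤ)) 0 1 = -1 → ((((β : SL(2, ℤ)) 1 1 : ℤ) : ZMod p)) = r → χ β = 0 := by
    intro r hr h1
    obtain ⟨s, hs⟩ := (ZMod.euler_criterion p hr).mpr h1
    have hs0 : s ≠ 0 := by rintro rfl; rw [mul_zero] at hs; exact hr hs
    rw [hs]
    exact K_sq_of_cyclotomic_pairs hp2 hpairs hadd hsmall hkill hs0
  have hEnon : ∀ r r' : ZMod p, r ≠ 0 → r' ≠ 0 → r ^ (p / 2) = -1 → r' ^ (p / 2) = -1 →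
      ∀ β β' : Gamma0 p, (β : SL(2, ℤ)) 0 1 = -1 → (β' : SL(2, ℤ)) 0 1 = -1 →
        ((((β : SL(2, ℤ)) 1 1 : ℤ) : ZMod p)) = r → ((((β' : SL(2, ℤ)) 1 1 : ℤ) : ZMod p)) = r' → χ β = χ β' := by
    intro r r' hr hr' h1 h1'
    have hq0 : r * r'⁻¹ ≠ 0 := mul_ne_zero hr (inv_ne_zero hr')
    have hq : (r * r'⁻¹) ^ (p / 2) = 1 := by
      rw [mul_pow, inv_pow, h1, h1']
      field_simp
    obtain ⟨s, hs⟩ := (ZMod.euler_criterion p hq0).mpr hq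
    have hs0 : s ≠ 0 := by rintro rfl; rw [mul_zero] at hs; exact hq0 hs
    exact E_of_div_sq_of_cyclotomic_pairs hp2 hpairs hadd hsmall hkill hr hr' hs0 hs
  by_cases h8 : p % 8 = 1
  · -- Eisenstein levels: the quadratic assembly
    obtain ⟨r₀, hr₀⟩ := FiniteField.exists_nonsquare (F := ZMod p) (by rw [ZMod.ringChar_zmod_n]; exact hp2)
    have hr₀0 : r₀ ≠ 0 := by rintro rfl; exact hr₀ ⟨0, by simp⟩
    have hr₀' : r₀ ^ (p / 2) = -1 := by
      rcases ZMod.pow_div_two_eq_neg_one_or_one p hr₀0 with h | h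
      · exact absurd ((ZMod.euler_criterion p hr₀0).mpr h) hr₀
      · exact h
    refine cuspSpanTrace_of_quadratic_certificate hp2 h8 hadd hsmall r₀ hr₀0 fun r hr ↦ ?_
    rcases ZMod.pow_div_two_eq_neg_one_or_one p hr with h | h
    · exact Or.inl ⟨h, hKres r hr h⟩
    · exact Or.inr ⟨h, hEnon r r₀ hr hr₀0 h hr₀'⟩
  · -- otherwise a non-residue elementary zero kills all non-residues
    have hz : ∃ z : ZMod p, z ≠ 0 ∧ z ^ (p / 2) = -1 ∧
        ∀ β : Gamma0 p, (β : SL(2, ℤ)) 0 1 = -1 → ((((β : SL(2, ℤ)) 1 1 : ℤ) : ZMod p)) = z → χ β = 0 := by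
      have hodd : p % 2 = 1 := Nat.odd_iff.mp (hp.odd_of_ne_two hp2)
      by_cases h4 : p % 4 = 3
      · refine ⟨-1, neg_ne_zero.mpr one_ne_zero, ?_, fun β hb hd ↦
          chi_eq_zero_of_b_neg_one_of_elementary hadd hsmall hb hd (Or.inr (Or.inl rfl))⟩
        have : p / 2 = 2 * (p / 4) + 1 := by omega
        rw [this]; exact Odd.neg_one_pow ⟨p / 4, rfl⟩
      · have h5 : p % 8 = 5 := by omega
        obtain ⟨i, hi⟩ := ZMod.exists_sq_eq_neg_one_iff.mpr h4
        have hi' : i * i = -1 := hi.symm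
        have hi0 : i ≠ 0 := by
          rintro rfl; rw [mul_zero] at hi'; exact (neg_ne_zero.mpr (one_ne_zero : (1 : ZMod p) ≠ 0)) hi'.symm
        refine ⟨i, hi0, ?_, fun β hb hd ↦
          chi_eq_zero_of_b_neg_one_of_elementary hadd hsmall hb hd (Or.inr (Or.inr (Or.inl hi')))⟩
        have : p / 2 = 2 * (p / 4) := by omega
        rw [this, pow_mul, sq, hi']
        exact Odd.neg_one_pow ⟨p / 8, by omega⟩
    obtain ⟨z, hz0, hzpow, hKz⟩ := hz
    have hB : ∀ β : Gamma0 p, (β : SL(2, ℤ)) 0 1 = -1 → χ β = 0 := by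
      intro β hb
      have hr : ((((β : SL(2, ℤ)) 1 1 : ℤ) : ZMod p)) ≠ 0 := (isUnit_gamma0_apply_one_one β).ne_zero
      rcases ZMod.pow_div_two_eq_neg_one_or_one p hr with h | h
      · exact hKres _ hr h β hb rfl
      · obtain ⟨βz, hbz, hdz⟩ := exists_b_neg_one_of_isUnit (N := p) (isUnit_iff_ne_zero.mpr hz0)
        rw [hEnon _ z hr hz0 h hzpow β βz hb hbz rfl hdz, hKz βz hbz hdz]
    have hsucc : ∀ δ : ℤ, IsUnit ((δ : ℤ) : ZMod p) ∨ IsUnit (((δ + 1 : ℤ)) : ZMod p) := by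
      intro δ
      have h := isUnit_or_isUnit_succ_of_primePow (p := p) (e := 1) hp δ
      rw [pow_one] at h
      exact h
    exact ⟨fun _ ↦ 0, fun _ _ _ _ ↦ by simp,
      fun γ ↦ chi_eq_zero_of_forall_b1 hsucc hadd hsmall (forall_b1_of_forall_b_neg_one hadd hB) γ⟩

/-- **THEOREM G (the named node).** Cyclotomic completeness at an odd prime `p` ⟹ `CuspSpanEvenAtTwo p`.
[cite: Pollack2003, Conj. 6.3] -/
theorem cuspSpanEvenAtTwo_of_cyclotomic_pairs (hp2 : p ≠ 2)
    (hpairs : ∀ x y : ZMod p, x ≠ 0 → y ≠ 0 → ∃ k l : ℕ, (4 : ZMod p) ^ k * x + 4 ^ l * y = 1) :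
    CuspSpanEvenAtTwo p :=
  cuspSpanEvenAtTwo_of_cuspSpanTrace (cuspSpanTrace_of_cyclotomic_pairs hp2 hpairs)

/-- **THEOREM G, finite-check form**: exponents bounded by `K` (e.g. `K = ord_p 4`), decidable per level. [cite: Pollack2003, Conj. 6.3] -/
theorem cuspSpanEvenAtTwo_of_cyclotomic_finiteCheck (hp2 : p ≠ 2) (K : ℕ)
    (h : ∀ x y : ZMod p, x ≠ 0 → y ≠ 0 → ∃ k l : Fin K, (4 : ZMod p) ^ (k : ℕ) * x + 4 ^ (l : ℕ) * y = 1) :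
    CuspSpanEvenAtTwo p :=
  cuspSpanEvenAtTwo_of_cyclotomic_pairs hp2 fun x y hx hy ↦ by
    obtain ⟨k, l, hkl⟩ := h x y hx hy
    exact ⟨k, l, hkl⟩

end PrimeLevel

end Summit.BirchSwinnertonDyer.BirchSwinnertonDyer.Theorems.SignedMuAtTwo

end
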